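import Literature.NumberTheory.GelbartRogawski1991.FiniteAdelicRationalImplementer
import Literature.NumberTheory.GelbartRogawski1991.LocalLeraySection
import Literature.NumberTheory.Weil1964.AdelicMetaplecticRationalLift
import HarnessLib

/-!
# The local implementer FAMILY of a rational symplectic element, normalised at almost every place

Topic `NumberTheory/GelbartRogawski1991`; namespace `Literature.NumberTheory.GelbartRogawski1991.UnitaryDualPair.LocalSplitting`
(the namespace of ★ `FiniteAdelicRationalImplementer` / ★ `RationalSymplecticUnramifiedVector`).  THEOREMS ONLY (no definition,
no named fact, no instance, no `sorry`).  Cell `hodgecm-mathlib`, (β)-glue of `A-plan/GS6-HOIST-SPEC.md` §9, piece (T5a) of node (T)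
«frame independence of `ω(μ,ε,χ)`» («★ `FiniteAdelicRationalImplementer` §4–§5 needs a local implementer family as INPUT»).  Books 0:
nothing here is a named fact or moves a binder of HC_CM.

SETTING ([Weil1964] Chap. III n° 37–40; [MoeglinVignerasWaldspurger1987] Chap. 2 II.1, II.10; [GelbartRogawski1991] §3.1).  A number
field `F`, a rational Gram matrix `T ∈ GL_N(F)` (`hTd`), the local Schrödinger models `localSchrodinger F N T v` on `𝒮(F_vᴺ)` and, for a
RATIONAL symplectic matrix `γ ∈ Sp_{2N}(F)`, its localisations `ratSpLoc F N T hTd v γ ∈ Sp(𝕎_v)` (★ `RationalSymplecticUnramifiedVector` §1).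
★ `FiniteAdelicRationalImplementer.exists_arch_tmul` turns a FAMILY `M = (M_v)_v` of local implementers of the `γ_v` fixing `1_{𝒪_vᴺ}`
for almost all `v` into the tensor form `ω(p) = A ⊗ ⊗'_v M_v` of every continuous lift `p` of `ratSp γ`; this file SUPPLIES the family.

RESULTS.
* §1 (generic, [MVW87] II.1 (A)) `Implements.mul_scalarOp` — an implementer rescaled by a unit is an implementer.
* §2 **`exists_implementer_family`** — for every `γ ∈ Sp_{2N}(F)` there is a family `M_v ∈ GL(𝒮(F_vᴺ))` of implementers of
  `ratSpLoc v γ` (★ `existsImplementer_localSchrodinger`, every place) with `M_v 1_{𝒪_vᴺ} = 1_{𝒪_vᴺ}` for almost all `v` (★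
  `eventually_exists_smul_unitVec` under ★ `implementerUniqueUpToScalar_localSchrodinger`: a.e. EVERY implementer has `1_{𝒪_vᴺ}` as an
  eigenvector, `M_v⁰ 1 = c_v • 1`, and `M_v := M_v⁰ · c_v⁻¹` is again an implementer, §1).
* §3 **`exists_omega_tmul_of_proj_eq_ratSp`** — hence for every `q ∈ Mp_ψ(𝕎_𝔸)ᶜᵒⁿᵗ` over `ratSp γ` (e.g. Weil's `r_F(γ)`, ★
  `ratPointsThetaLiftCont`): `ω(q)(Φ_∞ ⊗ f) = A Φ_∞ ⊗ (⊗'M_v) f` and `ω(q⁻¹)(Φ_∞ ⊗ f) = A⁻¹ Φ_∞ ⊗ (⊗'M_v)⁻¹ f` with `A` a topological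
  automorphism of `𝓢((F ⊗ ℝ)ᴺ)` — LITERALLY the hypotheses `hq`, `hq'` of (T5b) `Weil1964.finRepMp_conj_apply_clE`
  (`Weil1964/AdelicMetaplecticFinRepTensorConj`), so that `finRepMp (s^q) h = (⊗'M_v).conj (finRepMp s h)` for every admissible `s`.

* §4 **arbitrary index type** (`ι`, e.g. the Kronecker index `Fin N × Fin M` of a dual pair, Gram `(T_V ⊗ₖ T_W) ⊗ 1`):
  `exists_omega_tmul_of_proj_eq_ratSpι` — the same tensor form for every `r ∈ Mp_ψ(𝕎_𝔸)ᶜᵒⁿᵗ` over a rational point `ratSpι γ₀`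
  (transport along ★ `adelicMpContReindex F (Fintype.equivFin ι)`: ★ `spReindex_ratSpι`, §3 on `Fin (card ι)`, back with ★
  `adelicMpCont.omega_reindex_apply` / ★ `piSBReindex_tmul`; the archimedean leg is conjugated by the reindexing operators ★
  `schwartzReindexCLM e^{±1}` (packaged in place by `ContinuousLinearEquiv.equivOfInverse`), the finite leg by ★ `finSBReindex`), and
  `exists_omega_tmul_ratPointsThetaLiftCont` — the instance `r = r_F(h)` for a rational point `h` given as a member of the range
  subgroup (★ `ratPointsThetaLiftCont`).

## References
* [Weil1964] A. Weil, *Sur certains groupes d'opérateurs unitaires*, Acta Math. 111 (1964), Chap. III n° 37–38 pp. 188–189, n° 40 pp. 190–191.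
* [MoeglinVignerasWaldspurger1987] C. Mœglin, M.-F. Vignéras, J.-L. Waldspurger, LNM 1291 (1987), Chap. 2 II.1 (A)–(B), II.6, II.10.
* [GelbartRogawski1991] S. Gelbart, J. Rogawski, Invent. Math. 105 (1991), §3.1 Prop. 3.1.1 pp. 454–456, (3.1.3).
-/

set_option autoImplicit false

noncomputable section

open scoped Matrix TensorProduct Classical
open NumberField NumberField.mixedEmbedding IsDedekindDomain Filter
open Literature.RepresentationTheory.HeisenbergGroup
open Literature.NumberTheory.Automorphic
open Literature.NumberTheory.Weil1964

/-! ### §1 Rescaling an implementer (generic) -/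

namespace Literature.RepresentationTheory.HeisenbergGroup

section Generic

variable {R : Type*} [CommRing R] {V : Type*} [AddCommGroup V] [Module R V] {B : V →ₗ[R] V →ₗ[R] R}
  {k : Type*} [CommRing k] {S : Type*} [AddCommGroup S] [Module k S] (ρ : Representation k (Heisenberg B) S)

/-- **an implementer rescaled by a unit is an implementer**: condition (A) `M ρ(h) = ρ(s·h) M` is `k`-linear in `M`.
[cite: MoeglinVignerasWaldspurger1987, Chap. 2 II.1 (A)] -/
theorem Implements.mul_scalarOp {s : Heisenberg.PseudoSymplectic B} {M : S ≃ₗ[k] S} (hM : Implements ρ s M) (c : kˣ) :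
    Implements ρ s (M * scalarOp c) := by
  intro h f
  rw [LinearEquiv.mul_apply, LinearEquiv.mul_apply, scalarOp_apply, scalarOp_apply, map_smul M, hM h f,
    map_smul M, map_smul (ρ (s.act h))]

/-- the rescaled implementer on a `c`-eigenvector: `(M · c⁻¹) f = M f / c`, so `M f = c • f ⇒ (M · c⁻¹) f = f`.
[cite: MoeglinVignerasWaldspurger1987, Chap. 2 II.1 (A)] -/
theorem mul_scalarOp_inv_apply_of_eq_smul {M : S ≃ₗ[k] S} {c : kˣ} {f : S} (hf : M f = (c : k) • f) :
    (M * scalarOp c⁻¹ : S ≃ₗ[k] S) f = f := by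
  rw [LinearEquiv.mul_apply, scalarOp_apply, map_smul M, hf, smul_smul, Units.inv_mul, one_smul]

end Generic

end Literature.RepresentationTheory.HeisenbergGroup

namespace Literature.NumberTheory.GelbartRogawski1991.UnitaryDualPair.LocalSplitting

variable (F : Type) [Field F] [NumberField F] (N : ℕ) (T : Matrix (Fin N) (Fin N) F) (hTd : IsUnit T.det)

/-! ### §2 The normalised implementer family of a rational symplectic matrix -/

include hTd in
/-- **the local implementer family of a rational `γ ∈ Sp_{2N}(F)`, normalised a.e.**: there are `M_v ∈ GL(𝒮(F_vᴺ))`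
implementing `γ_v = ratSpLoc v γ` on the local Schrödinger model at EVERY finite place, with `M_v 1_{𝒪_vᴺ} = 1_{𝒪_vᴺ}` for ALMOST
ALL `v`.  Existence at each place is ★ `existsImplementer_localSchrodinger` ([MVW87] II.1 (A), II.6); at almost every place every
implementer has `1_{𝒪_vᴺ}` as an eigenvector (★ `eventually_exists_smul_unitVec`, [Weil1964] n° 38, [MVW87] II.10, under the
uniqueness ★ `implementerUniqueUpToScalar_localSchrodinger`), and dividing by the eigenvalue keeps an implementer (§1).
[cite: Weil1964, Chap. III n° 38 pp. 188–189] [cite: MoeglinVignerasWaldspurger1987, Chap. 2 II.1 (A), II.10] [cite: GelbartRogawski1991, §3.1 (3.1.3) p. 456] -/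
theorem exists_implementer_family (γ : Matrix.symplecticGroup (Fin N) F) :
    ∃ M : ∀ v : HeightOneSpectrum (𝓞 F),
        SchwartzBruhat (Fin N → v.adicCompletion F) ≃ₗ[ℂ] SchwartzBruhat (Fin N → v.adicCompletion F),
      (∀ v, Implements (localSchrodinger F N T v) (ofSymplectic _ (ratSpLoc F N T hTd v γ)) (M v)) ∧
        ∀ᶠ v in cofinite, M v (unitVec F (Fin N) v) = unitVec F (Fin N) v := by
  have hE : ∀ v : HeightOneSpectrum (𝓞 F),
      ∃ M : SchwartzBruhat (Fin N → v.adicCompletion F) ≃ₗ[ℂ] SchwartzBruhat (Fin N → v.adicCompletion F),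
        Implements (localSchrodinger F N T v) (ofSymplectic _ (ratSpLoc F N T hTd v γ)) M :=
    fun v => existsImplementer_localSchrodinger F N T hTd v (ratSpLoc F N T hTd v γ)
  choose M₀ hM₀ using hE
  -- the eigenvalue of `M₀ v` on `1_{𝒪_vᴺ}` where there is one, else `1`
  let c : ∀ v : HeightOneSpectrum (𝓞 F), ℂˣ := fun v =>
    if h : ∃ c : ℂˣ, M₀ v (unitVec F (Fin N) v) = (c : ℂ) • unitVec F (Fin N) v then h.choose else 1
  refine ⟨fun v => M₀ v * scalarOp (c v)⁻¹, fun v => (hM₀ v).mul_scalarOp _ _, ?_⟩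
  filter_upwards [eventually_exists_smul_unitVec F N T hTd γ
    (fun v => implementerUniqueUpToScalar_localSchrodinger F N T hTd v)] with v hv
  have h' : ∃ c : ℂˣ, M₀ v (unitVec F (Fin N) v) = (c : ℂ) • unitVec F (Fin N) v := hv (M₀ v) (hM₀ v)
  have hc : M₀ v (unitVec F (Fin N) v) = (c v : ℂ) • unitVec F (Fin N) v := by
    have e : c v = h'.choose := dif_pos h'
    rw [e]
    exact h'.choose_spec
  exact mul_scalarOp_inv_apply_of_eq_smul hc

/-! ### §3 Tensor form of every continuous lift of `ratSp γ` (the hypotheses of (T5b)) -/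

/-- bridge: `ω(q) Ψ = M_q Ψ` on the group of record (`adelicMpCont.omega` is the operator component).
[cite: GelbartRogawski1991, §3.1 p. 454] -/
theorem adelicMpCont_omega_apply_eq_snd {ι : Type} [Fintype ι] [DecidableEq ι] {𝕋 : Matrix ι ι (AdeleRing (𝓞 F) F)}
    (q : adelicMpCont F ι 𝕋) (Ψ : piSchwartzBruhat F ι) :
    adelicMpCont.omega F ι 𝕋 q Ψ =
      ((q : adelicMp F ι 𝕋) : symplecticGroup (polar (Weil1964.adelicForm F ι 𝕋)) ×
        (piSchwartzBruhat F ι ≃ₗ[ℂ] piSchwartzBruhat F ι)).2 Ψ := rfl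

/-- bridge: `ω(q⁻¹) Ψ = M_q⁻¹ Ψ` on the group of record (inversion is componentwise on the group of pairs, and the inverse of a
linear automorphism is its `symm`). [cite: GelbartRogawski1991, §3.1 p. 454] -/
theorem adelicMpCont_omega_inv_apply_eq_snd_symm {ι : Type} [Fintype ι] [DecidableEq ι] {𝕋 : Matrix ι ι (AdeleRing (𝓞 F) F)}
    (q : adelicMpCont F ι 𝕋) (Ψ : piSchwartzBruhat F ι) :
    adelicMpCont.omega F ι 𝕋 q⁻¹ Ψ =
      ((q : adelicMp F ι 𝕋) : symplecticGroup (polar (Weil1964.adelicForm F ι 𝕋)) ×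
        (piSchwartzBruhat F ι ≃ₗ[ℂ] piSchwartzBruhat F ι)).2.symm Ψ := rfl

include hTd in
/-- **`ω(q) = A ⊗ ⊗'_v M_v` for every `q ∈ Mp_ψ(𝕎_𝔸)ᶜᵒⁿᵗ` over a RATIONAL `γ`**, with `(M_v)` the normalised implementer family of §2
and `A` a topological automorphism of `𝓢((F ⊗ ℝ)ᴺ)`: on pure tensors `ω(q)(Φ_∞ ⊗ f) = A Φ_∞ ⊗ (⊗'M_v) f` and
`ω(q⁻¹)(Φ_∞ ⊗ f) = A⁻¹ Φ_∞ ⊗ (⊗'M_v)⁻¹ f` (★ `exists_arch_tmul` on the family of §2, read through the two bridges).  These are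
verbatim the hypotheses `hq`, `hq'` of (T5b) `finRepMp_conj_apply_clE`; the hypothesis `hproj` is ★ `exists_arch_tmul`'s (for `q` with
`adelicMpCont.proj … q = ratSp … γ` rewrite with the `rfl`-lemmas ★ `adelicMpCont.proj_apply`, ★ `MpPsi.proj_apply`).
[cite: Weil1964, Chap. III n° 38–40 pp. 188–191] [cite: GelbartRogawski1991, §3.1 Prop. 3.1.1 p. 455] -/
theorem exists_omega_tmul_of_proj_eq_ratSp (γ : Matrix.symplecticGroup (Fin N) F)
    (q : adelicMpCont F (Fin N) (T.map (algebraMap F (AdeleRing (𝓞 F) F))))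
    (hproj : ((q : adelicMp F (Fin N) (T.map (algebraMap F (AdeleRing (𝓞 F) F)))) :
        symplecticGroup (polar (Weil1964.adelicForm F (Fin N) (T.map (algebraMap F (AdeleRing (𝓞 F) F))))) ×
          (piSchwartzBruhat F (Fin N) ≃ₗ[ℂ] piSchwartzBruhat F (Fin N))).1 =
      ratSp F (T.map (algebraMap F (AdeleRing (𝓞 F) F))) (isUnit_det_gramAdele F N T hTd) γ) :
    ∃ (M : ∀ v : HeightOneSpectrum (𝓞 F),
        SchwartzBruhat (Fin N → v.adicCompletion F) ≃ₗ[ℂ] SchwartzBruhat (Fin N → v.adicCompletion F))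
      (hM1 : ∀ᶠ v in cofinite, M v (unitVec F (Fin N) v) = unitVec F (Fin N) v)
      (A : SchwartzMap (Fin N → mixedSpace F) ℂ ≃L[ℂ] SchwartzMap (Fin N → mixedSpace F) ℂ),
      (∀ v, Implements (localSchrodinger F N T v) (ofSymplectic _ (ratSpLoc F N T hTd v γ)) (M v)) ∧
      (∀ (Φinf : SchwartzMap (Fin N → mixedSpace F) ℂ) (f : FinSB F (Fin N)),
        adelicMpCont.omega F (Fin N) (T.map (algebraMap F (AdeleRing (𝓞 F) F))) q
            (piSchwartzBruhatEquiv F (Fin N) (Φinf ⊗ₜ f)) =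
          piSchwartzBruhatEquiv F (Fin N) (A Φinf ⊗ₜ piEquiv M hM1 f)) ∧
      ∀ (Φinf : SchwartzMap (Fin N → mixedSpace F) ℂ) (f : FinSB F (Fin N)),
        adelicMpCont.omega F (Fin N) (T.map (algebraMap F (AdeleRing (𝓞 F) F))) q⁻¹
            (piSchwartzBruhatEquiv F (Fin N) (Φinf ⊗ₜ f)) =
          piSchwartzBruhatEquiv F (Fin N) (A.symm Φinf ⊗ₜ (piEquiv M hM1).symm f) := by
  -- (term-style destructuring: `obtain ⟨M, hM, hM1⟩` on this goal runs into an `isDefEq` heartbeat time-out)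
  have h := exists_implementer_family F N T hTd γ
  refine h.elim fun M hM => ?_
  have h1 := exists_arch_tmul T hTd γ M hM.1 hM.2
  have h2 := h1 (q : adelicMp F (Fin N) _) q.2
  have h3 := h2 hproj
  refine h3.elim fun A hA => ?_
  refine ⟨M, hM.2, A, hM.1, fun Φinf f => ?_, fun Φinf f => ?_⟩
  · exact (adelicMpCont_omega_apply_eq_snd F q _).trans (hA Φinf f).1
  · exact (adelicMpCont_omega_inv_apply_eq_snd_symm F q _).trans (hA Φinf f).2


/-! ### §4 Arbitrary index type: transport along `Mp_ψ(W_T) ≃* Mp_ψ(W_{reindex e e T})` -/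

section AnyIndex

variable {F}
variable {ι : Type} [Fintype ι] [DecidableEq ι]

omit [DecidableEq ι] in
/-- `R_{e⁻¹}^∞ (R_e^∞ φ) = φ` (the archimedean reindexing operators ★ `schwartzReindexCLM` along `e` and `e⁻¹` are inverse).
[cite: MoeglinVignerasWaldspurger1987, Chap. 2 I.4 Exemple (1)] -/
theorem schwartzReindexCLM_symm_apply_apply {ι' : Type} [Fintype ι'] (e : ι ≃ ι')
    (φ : SchwartzMap (ι → mixedSpace F) ℂ) : schwartzReindexCLM F e.symm (schwartzReindexCLM F e φ) = φ := by
  ext w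
  rw [schwartzReindexCLM_apply, schwartzReindexCLM_apply]
  exact congrArg φ (funext fun i => congrArg w (e.symm_apply_apply i))

omit [DecidableEq ι] in
/-- `R_e^∞ (R_{e⁻¹}^∞ φ) = φ`. [cite: MoeglinVignerasWaldspurger1987, Chap. 2 I.4 Exemple (1)] -/
theorem schwartzReindexCLM_apply_symm_apply {ι' : Type} [Fintype ι'] (e : ι ≃ ι')
    (φ : SchwartzMap (ι' → mixedSpace F) ℂ) : schwartzReindexCLM F e (schwartzReindexCLM F e.symm φ) = φ := by
  ext w
  rw [schwartzReindexCLM_apply, schwartzReindexCLM_apply]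
  exact congrArg φ (funext fun i => congrArg w (e.apply_symm_apply i))

/-- **tensor form over a rational point, ANY index type**: for `𝕋 = T ⊗ 1` with `T ∈ GL_ι(F)` rational, `γ₀ ∈ Sp_{2ι}(F)` and ANY
`r ∈ Mp_ψ(W_𝕋)ᶜᵒⁿᵗ` with `π(r) = ratSpι γ₀`, there are a topological automorphism `A` of `𝓢((F ⊗ ℝ)^ι)` and a linear automorphism
`Q_f` of `𝒮((𝔸_F^∞)^ι)` with `ω(r)(Φ_∞ ⊗ f) = A Φ_∞ ⊗ Q_f f` and `ω(r⁻¹)(Φ_∞ ⊗ f) = A⁻¹ Φ_∞ ⊗ Q_f⁻¹ f`.  (`h𝕋` lets the consumer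
keep its literal Gram, e.g. `(T_V ⊗ 1) ⊗ₖ (T_W ⊗ 1) = (T_V ⊗ₖ T_W) ⊗ 1`.)  Proof: reindex along `e : ι ≃ Fin (card ι)`
(`π(reindex r) = spReindex e (π r) = ratSp (reindex γ₀)`, ★ `spReindex_ratSpι`), apply §3 there, and transport back through
★ `adelicMpCont.omega_reindex_apply` and ★ `piSBReindex_tmul`.
[cite: Weil1964, Chap. III n° 38–40 pp. 188–191] [cite: GelbartRogawski1991, §3.1 Prop. 3.1.1 p. 455] -/
theorem exists_omega_tmul_of_proj_eq_ratSpι (TR : Matrix ι ι F) (hTRd : IsUnit TR.det) {𝕋 : Matrix ι ι (AdeleRing (𝓞 F) F)}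
    (h𝕋 : 𝕋 = TR.map (algebraMap F (AdeleRing (𝓞 F) F))) (h𝕋d : IsUnit 𝕋.det)
    (γ₀ : Matrix.symplecticGroup ι F) (r : adelicMpCont F ι 𝕋)
    (hproj : adelicMpCont.proj F ι 𝕋 r = ratSpι F ι 𝕋 h𝕋d γ₀) :
    ∃ (A : SchwartzMap (ι → mixedSpace F) ℂ ≃L[ℂ] SchwartzMap (ι → mixedSpace F) ℂ) (Q : FinSB F ι ≃ₗ[ℂ] FinSB F ι),
      (∀ (Φinf : SchwartzMap (ι → mixedSpace F) ℂ) (f : FinSB F ι),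
        adelicMpCont.omega F ι 𝕋 r (piSchwartzBruhatEquiv F ι (Φinf ⊗ₜ f)) =
          piSchwartzBruhatEquiv F ι (A Φinf ⊗ₜ Q f)) ∧
      ∀ (Φinf : SchwartzMap (ι → mixedSpace F) ℂ) (f : FinSB F ι),
        adelicMpCont.omega F ι 𝕋 r⁻¹ (piSchwartzBruhatEquiv F ι (Φinf ⊗ₜ f)) =
          piSchwartzBruhatEquiv F ι (A.symm Φinf ⊗ₜ Q.symm f) := by
  subst h𝕋
  -- reindex along some `e : ι ≃ Fin n`
  refine (⟨Fintype.card ι, ⟨Fintype.equivFin ι⟩⟩ : ∃ n : ℕ, Nonempty (ι ≃ Fin n)).elim fun n hn => hn.elim fun e => ?_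
  have hT'd : IsUnit (Matrix.reindex e e TR).det := by rw [Matrix.det_reindex_self]; exact hTRd
  -- the reindexed element, read at the Gram matrix `(reindex e e TR) ⊗ 1 = reindex e e (TR ⊗ 1)` (definitional)
  let q : adelicMpCont F (Fin n) ((Matrix.reindex e e TR).map (algebraMap F (AdeleRing (𝓞 F) F))) :=
    adelicMpContReindex F e (TR.map (algebraMap F (AdeleRing (𝓞 F) F))) r
  have hq : ((q : adelicMp F (Fin n) ((Matrix.reindex e e TR).map (algebraMap F (AdeleRing (𝓞 F) F)))) :
        symplecticGroup (polar (Weil1964.adelicForm F (Fin n)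
          ((Matrix.reindex e e TR).map (algebraMap F (AdeleRing (𝓞 F) F))))) ×
          (piSchwartzBruhat F (Fin n) ≃ₗ[ℂ] piSchwartzBruhat F (Fin n))).1 =
      ratSp F ((Matrix.reindex e e TR).map (algebraMap F (AdeleRing (𝓞 F) F)))
        (isUnit_det_gramAdele F n (Matrix.reindex e e TR) hT'd) (spMatrixReindex e γ₀) := by
    have h1 : adelicMpCont.proj F (Fin n) _ (adelicMpContReindex F e (TR.map (algebraMap F (AdeleRing (𝓞 F) F))) r) =
        ratSpι F (Fin n) _ (isUnit_det_reindex e _ h𝕋d) (spMatrixReindex e γ₀) :=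
      ((adelicMpCont.proj_reindex F e _ r).trans (congrArg (UnitaryGroup.spReindex e _) hproj)).trans
        (spReindex_ratSpι F ι _ h𝕋d e γ₀)
    exact h1
  -- §3 on `Fin n`
  have h3 := exists_omega_tmul_of_proj_eq_ratSp F n (Matrix.reindex e e TR) hT'd (spMatrixReindex e γ₀) q hq
  refine h3.elim fun M hM => hM.elim fun hM1 hA => hA.elim fun A hA' => ?_
  -- the archimedean leg `R_{e⁻¹}^∞ ∘ A ∘ R_e^∞` as a topological automorphism (inverse `R_{e⁻¹}^∞ ∘ A⁻¹ ∘ R_e^∞`), built in place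
  refine ⟨ContinuousLinearEquiv.equivOfInverse
      ((schwartzReindexCLM F e.symm).comp ((A : SchwartzMap (Fin n → mixedSpace F) ℂ →L[ℂ]
        SchwartzMap (Fin n → mixedSpace F) ℂ).comp (schwartzReindexCLM F e)))
      ((schwartzReindexCLM F e.symm).comp ((A.symm : SchwartzMap (Fin n → mixedSpace F) ℂ →L[ℂ]
        SchwartzMap (Fin n → mixedSpace F) ℂ).comp (schwartzReindexCLM F e)))
      (fun φ => by
        show schwartzReindexCLM F e.symm (A.symm (schwartzReindexCLM F e
          (schwartzReindexCLM F e.symm (A (schwartzReindexCLM F e φ))))) = φ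
        rw [schwartzReindexCLM_apply_symm_apply, ContinuousLinearEquiv.symm_apply_apply,
          schwartzReindexCLM_symm_apply_apply])
      (fun φ => by
        show schwartzReindexCLM F e.symm (A (schwartzReindexCLM F e
          (schwartzReindexCLM F e.symm (A.symm (schwartzReindexCLM F e φ))))) = φ
        rw [schwartzReindexCLM_apply_symm_apply, ContinuousLinearEquiv.apply_symm_apply,
          schwartzReindexCLM_symm_apply_apply]),
    (finSBReindex F e).trans ((piEquiv M hM1).trans (finSBReindex F e).symm), fun Φinf f => ?_, fun Φinf f => ?_⟩
  · -- `ω(r) X = R_e⁻¹ (ω(reindex r) (R_e X))`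
    have step : piSBReindex F e (adelicMpCont.omega F ι _ r (piSchwartzBruhatEquiv F ι (Φinf ⊗ₜ f))) =
        adelicMpCont.omega F (Fin n) _ q (piSBReindex F e (piSchwartzBruhatEquiv F ι (Φinf ⊗ₜ f))) :=
      ((adelicMpCont.omega_reindex_apply F e _ r _).trans
        (congrArg (fun Y => piSBReindex F e (adelicMpCont.omega F ι _ r Y))
          ((piSBReindex F e).symm_apply_apply _))).symm
    have step2 : adelicMpCont.omega F ι _ r (piSchwartzBruhatEquiv F ι (Φinf ⊗ₜ f)) =
        (piSBReindex F e).symm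
          (adelicMpCont.omega F (Fin n) _ q (piSBReindex F e (piSchwartzBruhatEquiv F ι (Φinf ⊗ₜ f)))) :=
      (((piSBReindex F e).symm_apply_apply _).symm).trans (congrArg (piSBReindex F e).symm step)
    refine step2.trans ?_
    refine (congrArg (fun Y => (piSBReindex F e).symm (adelicMpCont.omega F (Fin n) _ q Y))
      (piSBReindex_tmul F e Φinf f)).trans ?_
    refine (congrArg (piSBReindex F e).symm (hA'.2.1 _ _)).trans ?_
    exact piSBReindex_tmul F e.symm _ _
  · -- the same for `r⁻¹`, `reindex (r⁻¹) = (reindex r)⁻¹`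
    have hinv : adelicMpContReindex F e (TR.map (algebraMap F (AdeleRing (𝓞 F) F))) r⁻¹ = q⁻¹ := map_inv _ r
    have step : piSBReindex F e (adelicMpCont.omega F ι _ r⁻¹ (piSchwartzBruhatEquiv F ι (Φinf ⊗ₜ f))) =
        adelicMpCont.omega F (Fin n) _ q⁻¹ (piSBReindex F e (piSchwartzBruhatEquiv F ι (Φinf ⊗ₜ f))) :=
      ((adelicMpCont.omega_reindex_apply F e _ r⁻¹ _).trans
        (congrArg (fun Y => piSBReindex F e (adelicMpCont.omega F ι _ r⁻¹ Y))
          ((piSBReindex F e).symm_apply_apply _))).symm.trans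
        (congrArg (fun p => adelicMpCont.omega F (Fin n) _ p
          (piSBReindex F e (piSchwartzBruhatEquiv F ι (Φinf ⊗ₜ f)))) hinv)
    have step2 : adelicMpCont.omega F ι _ r⁻¹ (piSchwartzBruhatEquiv F ι (Φinf ⊗ₜ f)) =
        (piSBReindex F e).symm
          (adelicMpCont.omega F (Fin n) _ q⁻¹ (piSBReindex F e (piSchwartzBruhatEquiv F ι (Φinf ⊗ₜ f)))) :=
      (((piSBReindex F e).symm_apply_apply _).symm).trans (congrArg (piSBReindex F e).symm step)
    refine step2.trans ?_
    refine (congrArg (fun Y => (piSBReindex F e).symm (adelicMpCont.omega F (Fin n) _ q⁻¹ Y))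
      (piSBReindex_tmul F e Φinf f)).trans ?_
    refine (congrArg (piSBReindex F e).symm (hA'.2.2 _ _)).trans ?_
    exact piSBReindex_tmul F e.symm _ _

/-- **the instance `r = r_F(h)`** (Weil's Θ-fixing continuous lift of a rational point `h ∈ Sp(W)(F)`, given as a member of the range
subgroup, ★ `ratPointsThetaLiftCont`): `ω(r_F h)(Φ_∞ ⊗ f) = A Φ_∞ ⊗ Q_f f`, `ω((r_F h)⁻¹)(Φ_∞ ⊗ f) = A⁻¹ Φ_∞ ⊗ Q_f⁻¹ f`.
[cite: Weil1964, Chap. III n° 38–40 pp. 188–191] [cite: GelbartRogawski1991, §3.1 p. 454] -/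
theorem exists_omega_tmul_ratPointsThetaLiftCont (TR : Matrix ι ι F) (hTRd : IsUnit TR.det)
    {𝕋 : Matrix ι ι (AdeleRing (𝓞 F) F)} (h𝕋 : 𝕋 = TR.map (algebraMap F (AdeleRing (𝓞 F) F))) (h𝕋d : IsUnit 𝕋.det)
    (g : ((SymplecticMatrix.transportSp 𝕋 h𝕋d).comp
      (SymplecticMatrix.mapHom (algebraMap F (AdeleRing (𝓞 F) F)))).range) :
    ∃ (A : SchwartzMap (ι → mixedSpace F) ℂ ≃L[ℂ] SchwartzMap (ι → mixedSpace F) ℂ) (Q : FinSB F ι ≃ₗ[ℂ] FinSB F ι),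
      (∀ (Φinf : SchwartzMap (ι → mixedSpace F) ℂ) (f : FinSB F ι),
        adelicMpCont.omega F ι 𝕋 (ratPointsThetaLiftCont F ι 𝕋 h𝕋d g) (piSchwartzBruhatEquiv F ι (Φinf ⊗ₜ f)) =
          piSchwartzBruhatEquiv F ι (A Φinf ⊗ₜ Q f)) ∧
      ∀ (Φinf : SchwartzMap (ι → mixedSpace F) ℂ) (f : FinSB F ι),
        adelicMpCont.omega F ι 𝕋 (ratPointsThetaLiftCont F ι 𝕋 h𝕋d g)⁻¹ (piSchwartzBruhatEquiv F ι (Φinf ⊗ₜ f)) =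
          piSchwartzBruhatEquiv F ι (A.symm Φinf ⊗ₜ Q.symm f) :=
  exists_omega_tmul_of_proj_eq_ratSpι TR hTRd h𝕋 h𝕋d ((ratSpιRangeEquiv F ι 𝕋 h𝕋d).symm g) _
    ((proj_ratPointsThetaLiftCont F ι 𝕋 h𝕋d g).trans (ratSpι_ratSpιRangeEquiv_symm F ι 𝕋 h𝕋d g).symm)

end AnyIndex

end Literature.NumberTheory.GelbartRogawski1991.UnitaryDualPair.LocalSplitting

end
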